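import Mathlib
import HarnessLib
import Summits.ResolutionOfSingularities.ResolutionOfSingularities.Theorems.WildQuotientsWildQuotientResolutionS1aChartRingNode
import Summits.ResolutionOfSingularities.ResolutionOfSingularities.Theorems.WildQuotientsWildQuotientResolutionS1aBlowupChartStable
import Summits.ResolutionOfSingularities.ResolutionOfSingularities.Theorems.WildQuotientsWildQuotientResolutionS1aNodeAtlas

/-!
# S1a — (T2e) FINITE TYPE OVER A NOETHERIAN BASE for node rings and chart rings

[OURS · L1 W4.5c · lead-1 g7; T2E-BRIEF (N3)/(N4) «`A` Noetherian»] — NOT statements of the manuscript; counted 0; AI-level work,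
weaker than expert review. Crux stmt-ResolutionOfSingularities-17941, line `s1a-logminvertex` v6, stub `stub_winningStrategy`.

The global Király–Lütkebohmert theorem (`…S1aInvariantsRegular`) and the invariant node (`…S1aInvariantNode`) need the node ring to be of
finite type over a Noetherian ring of `σ`-fixed degree-`0` elements. In the game this ring is the affine base `Spec R₀` (over which `G`
acts), and finite type is inherited chart by chart:
* `finiteType_gradeZero_of_T2` — (T2) `Subring.closure (𝒜 0 ∪ t) = ⊤` ⇒ `B` is of finite type over `𝒜 0`;
* **`exists_baseRingHom_of_nodeChart`** — for a `G`-equivariant `s : V ⟶ Spec R₀` locally of finite type and node-chart data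
  `(O; B, 𝒜, σ, e)` (`e : Γ(V, O) ≃+* 𝒜 0` intertwining `g₀` with `σ`, (T2)), there is `φ₀ : R₀ →+* B` of finite type with `σ`-fixed
  image inside `𝒜 0`;
* **`finiteType_ofBase_comp`** — finite type passes to the chart rings `R^w[(bT^d)⁻¹]` of a weighted blow-up (`CoarseChart.ofBase`):
  the cobordant algebra is a quotient of a polynomial ring (`cobordantAlgebra.presentation_surjective`) and the chart ring is a
  localisation away from one element.
-/

set_option linter.dupNamespace false

noncomputable section

open CategoryTheory AlgebraicGeometry TopologicalSpace
open Literature.AlgebraicGeometry.Resolution Literature.AlgebraicGeometry.RelativeSpec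
open Summit.ResolutionOfSingularities.ResolutionOfSingularities.Theorems.WildQuotientResolution.S1
open Summit.ResolutionOfSingularities.ResolutionOfSingularities.Theorems.WildQuotientResolution.S1.BlowupCharts

namespace Summit.ResolutionOfSingularities.ResolutionOfSingularities.Theorems.WildQuotientResolution.S1.InvariantsRegular

universe u v

/-! ## (T2) ⇒ finite type over the degree-0 part -/

/-- (T2) `Subring.closure (𝒜 0 ∪ t) = ⊤` ⇒ `B` is of finite type over `𝒜 0`. -/
theorem finiteType_gradeZero_of_T2 {ι : Type v} [AddCommGroup ι] [DecidableEq ι] {B : Type u} [CommRing B]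
    (𝒜 : ι → AddSubgroup B) [GradedRing 𝒜] (hT2 : ∃ t : Finset B, Subring.closure (((𝒜 0 : AddSubgroup B) : Set B) ∪ ↑t) = ⊤) :
    (algebraMap (↥(𝒜 0)) B).FiniteType := by
  classical
  obtain ⟨t, ht⟩ := hT2
  rw [RingHom.finiteType_algebraMap]
  refine ⟨⟨t, ?_⟩⟩
  apply Subalgebra.toSubring_injective
  rw [Algebra.adjoin_eq_ring_closure, Algebra.top_toSubring, ← ht]
  congr 2
  ext x
  exact ⟨by rintro ⟨y, rfl⟩; exact y.2, fun hx => ⟨⟨x, hx⟩, rfl⟩⟩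

/-! ## The base ring hom of a node chart -/

/-- **Finite type over the base, chart by chart.** Let `G` act on `V` over `Y`, let `s : V ⟶ Spec R₀` be `G`-invariant and locally of
finite type, and let `O` be a `G`-stable affine open carrying node data `(B, 𝒜, σ, e)` with (T2). Then there is a ring map
`φ₀ : R₀ →+* B` of finite type whose image consists of `σ`-fixed elements of degree `0`. [OURS · L1 W4.5c] -/
theorem exists_baseRingHom_of_nodeChart {V Y : Scheme.{u}} {q : V ⟶ Y} {G : Type*} [Group G] (ρ : ActionOver q G) (g₀ : G)
    {R₀ : Type u} [CommRing R₀] (s : V ⟶ Spec (.of R₀)) [LocallyOfFiniteType s]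
    (hs : ∀ g : G, (ρ.aut g).hom ≫ s = s) (O : ρ.StableAffineOpens) (hO : IsAffineOpen O.1)
    {ι : Type v} [AddCommGroup ι] [DecidableEq ι] {B : Type u} [CommRing B] (𝒜 : ι → AddSubgroup B) [GradedRing 𝒜]
    (σ : B ≃+* B) (e : Γ(V, O.1) ≃+* ↥(𝒜 0))
    (hσe : ∀ t : Γ(V, O.1),
      ((e ((ρ.aut g₀⁻¹).hom.appLE O.1 O.1 (O.2.1 g₀⁻¹).ge t) : ↥(𝒜 0)) : B) = σ ((e t : ↥(𝒜 0)) : B))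
    (hT2 : ∃ t : Finset B, Subring.closure (((𝒜 0 : AddSubgroup B) : Set B) ∪ ↑t) = ⊤) :
    ∃ φ₀ : R₀ →+* B, φ₀.FiniteType ∧ (∀ r, σ (φ₀ r) = φ₀ r) ∧ ∀ r, φ₀ r ∈ 𝒜 0 := by
  -- `R₀ ≅ Γ(Spec R₀, ⊤) → Γ(V, O)`
  let φ₁ : R₀ →+* Γ(V, O.1) := (s.appLE ⊤ O.1 le_top).hom.comp (Scheme.ΓSpecIso (.of R₀)).inv.hom
  have hφ₁ : φ₁.FiniteType := by
    refine RingHom.FiniteType.comp ?_ (RingHom.FiniteType.of_surjective _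
      (ConcreteCategory.bijective_of_isIso (Scheme.ΓSpecIso (.of R₀)).inv).2)
    exact HasRingHomProperty.appLE (P := @LocallyOfFiniteType) s inferInstance ⟨⊤, isAffineOpen_top _⟩ ⟨O.1, hO⟩ le_top
  -- the image of `R₀` is `G`-fixed
  have hfix : ∀ r, (ρ.aut g₀⁻¹).hom.appLE O.1 O.1 (O.2.1 g₀⁻¹).ge (φ₁ r) = φ₁ r := by
    intro r
    change ((s.appLE ⊤ O.1 le_top) ≫ (ρ.aut g₀⁻¹).hom.appLE O.1 O.1 (O.2.1 g₀⁻¹).ge) _ = (s.appLE ⊤ O.1 le_top) _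
    rw [Scheme.Hom.appLE_comp_appLE, appLE_congr_of_eq (hs g₀⁻¹) ⊤ O.1 _ le_top]
  refine ⟨(algebraMap (↥(𝒜 0)) B).comp ((e : Γ(V, O.1) →+* ↥(𝒜 0)).comp φ₁), ?_, fun r => ?_, fun r => (e (φ₁ r)).2⟩
  · exact (finiteType_gradeZero_of_T2 𝒜 hT2).comp
      ((RingHom.FiniteType.of_surjective _ e.surjective).comp hφ₁)
  · change σ ((e (φ₁ r) : ↥(𝒜 0)) : B) = ((e (φ₁ r) : ↥(𝒜 0)) : B)
    rw [← hσe, hfix]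

/-! ## Finite type of the chart rings -/

/-- **The chart ring `R^w[(bT^d)⁻¹]` is of finite type over any base over which `B` is.** [OURS · L1 W4.5c] -/
theorem finiteType_ofBase_comp {ι : Type v} [AddCommGroup ι] [DecidableEq ι] {B : Type u} [CommRing B]
    (𝒜 : ι → AddSubgroup B) [GradedRing 𝒜] {c : ℕ} (f : Fin c → B) (w : Fin c → ℕ)
    (d : ℕ) (b : ↥(𝒜 0)) (hb : b ∈ (CoarseChart.traceFiltration 𝒜 f w).ideal d)
    {R₀ : Type*} [CommRing R₀] (φ₀ : R₀ →+* B) (hφ₀ : φ₀.FiniteType) :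
    ((CoarseChart.ofBase 𝒜 f w d b hb).comp φ₀).FiniteType := by
  refine RingHom.FiniteType.comp ?_ hφ₀
  refine RingHom.FiniteType.comp ?_ ?_
  · rw [RingHom.finiteType_algebraMap]
    haveI := IsLocalization.Away.finitePresentation (CoarseChart.coverElement 𝒜 f w d b hb)
      (S := CoarseChart.ChartRing 𝒜 f w d b hb)
    infer_instance
  · rw [RingHom.finiteType_algebraMap]
    exact Algebra.FiniteType.of_surjective (cobordantAlgebra.presentation f w) (cobordantAlgebra.presentation_surjective f w)

end Summit.ResolutionOfSingularities.ResolutionOfSingularities.Theorems.WildQuotientResolution.S1.InvariantsRegular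

end
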